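import Literature.NumberTheory.Sieve.ParityWave0BombieriVinogradovProofs
import Literature.NumberTheory.Sieve.BombieriVinogradovMoebius
import Literature.NumberTheory.Sieve.RoughNumbersCoprimeProgressions
import HarnessLib

/-!
# Route `LeeYangFibres`, crux `RelativeDimOne` (stmt-Parity-14113), line `single-moebius-split`:
# helper file 2 for the stub `stub_moebiusTermBV` — Bombieri–Vinogradov for primes with a
# modulus-wise majorant

The tree's PROVED Bombieri–Vinogradov theorem `Literature.NumberTheory.Sieve.bombieri_vinogradov_holds`
bounds `∑_{q ≤ Q} max_{(a,q)=1} |ψ(y_q; q, a) − y_q/φ(q)|` for ONE cut-off `y_q ∈ [1, x]` per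
modulus.  The proof of `MoebiusTermBound` uses many cut-offs per modulus (one per tuple of sieve
divisors); `bvLambda_sup` repackages the theorem with the majorant
`G(q) = max_{1 ≤ w ≤ x} max_{(a,q)=1} |ψ(w; q, a) − w/φ(q)|` (a finite maximum, realised by a choice
of `y_q`): `G ≥ 0`, `G(q)` dominates every discrepancy with cut-off `≤ x`, `∑_{q ≤ Q} G(q) ≤ C x (log x)^{-A}`,
and the trivial bound `G(q) ≤ 3 x log x · τ(q)/q` (from `ψ(w; q, a) ≤ (x/q + 2) log x`,
`1/φ(q) ≤ τ(q)/q`), which feeds the Cauchy–Schwarz treatment of multiplicities.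

References: E. Bombieri, *On the large sieve*, Mathematika 12 (1965) [Bombieri1965]; H. Iwaniec,
E. Kowalski, *Analytic Number Theory* (2004), Thm. 17.1 [IwaniecKowalski2004].
-/

noncomputable section

open Finset Filter
open scoped ArithmeticFunction.vonMangoldt

namespace Summit.Parity.GeneralizedHardyLittlewood.Cruxes.RelativeDimOne.SingleMoebiusSplit

open Literature.NumberTheory.Sieve (bombieri_vinogradov_holds)
open Literature.NumberTheory.Sieve.ParityWave0 (chebyshevPsiMod)
open Literature.NumberTheory.Sieve.BVMoebius (eventually_log_rpow_le_rpow' inv_totient_le)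

/-! ### The trivial bound for `ψ(w; q, a)` -/

/-- A class `a (mod q)` has at most `x/q + 2` members in `[0, w]` for `w ≤ x`. [folklore] -/
theorem card_range_filter_zmod_le {q : ℕ} (hq : 0 < q) (a : ZMod q) (w : ℕ) {x : ℝ}
    (hwx : (w : ℝ) ≤ x) :
    (#((range (w + 1)).filter (fun n : ℕ => (n : ZMod q) = a)) : ℝ) ≤ x / q + 2 := by
  classical
  haveI : NeZero q := ⟨hq.ne'⟩
  have hsub : (range (w + 1)).filter (fun n : ℕ => (n : ZMod q) = a) ⊆
      insert 0 ((Ioc 0 w).filter (fun n : ℕ => n ≡ a.val [MOD q])) := by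
    intro n hn
    rw [mem_filter, mem_range] at hn
    rw [mem_insert, mem_filter, mem_Ioc]
    rcases Nat.eq_zero_or_pos n with h0 | hpos
    · exact Or.inl h0
    · refine Or.inr ⟨⟨hpos, by omega⟩, ?_⟩
      rw [← ZMod.natCast_eq_natCast_iff, ZMod.natCast_zmod_val]
      exact hn.2
  have hcard := Literature.NumberTheory.Sieve.BFI.abs_card_Ioc_filter_modEq_sub_le hq a.val
    (Nat.zero_le w)
  have h1 : (#((Ioc 0 w).filter (fun n : ℕ => n ≡ a.val [MOD q])) : ℝ) ≤ x / q + 1 := by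
    have h2 := (abs_le.1 hcard).2
    have hq' : (0 : ℝ) < q := by exact_mod_cast hq
    have h3 : ((w : ℝ) - (0 : ℕ)) / q ≤ x / q := by
      rw [Nat.cast_zero, sub_zero]; exact div_le_div_of_nonneg_right hwx hq'.le
    linarith
  calc (#((range (w + 1)).filter (fun n : ℕ => (n : ZMod q) = a)) : ℝ)
      ≤ #(insert 0 ((Ioc 0 w).filter (fun n : ℕ => n ≡ a.val [MOD q]))) := by
        exact_mod_cast card_le_card hsub
    _ ≤ #((Ioc 0 w).filter (fun n : ℕ => n ≡ a.val [MOD q])) + 1 := by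
        exact_mod_cast card_insert_le _ _
    _ ≤ x / q + 2 := by linarith

/-- **Chebyshev's bound in a progression** (trivial form): `ψ(w; q, a) ≤ (x/q + 2) log x` for
`w ≤ x`, `x ≥ 1`. [folklore] -/
theorem chebyshevPsiMod_le {q : ℕ} (hq : 0 < q) (a : ZMod q) (w : ℕ) {x : ℝ} (hx : 1 ≤ x)
    (hwx : (w : ℝ) ≤ x) : chebyshevPsiMod q a w ≤ (x / q + 2) * Real.log x := by
  classical
  have hlogx : 0 ≤ Real.log x := Real.log_nonneg hx
  unfold chebyshevPsiMod
  rw [Nat.floor_natCast]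
  have hterm : ∀ n ∈ range (w + 1), ArithmeticFunction.vonMangoldt.residueClass a n ≤
      if (n : ZMod q) = a then Real.log x else 0 := by
    intro n hn
    unfold ArithmeticFunction.vonMangoldt.residueClass
    rw [Set.indicator_apply]
    simp only [Set.mem_setOf_eq]
    split_ifs with h
    · rcases Nat.eq_zero_or_pos n with h0 | hpos
      · subst h0; simp [hlogx]
      · have hn1 : (1 : ℝ) ≤ n := by exact_mod_cast hpos
        have hnx : (n : ℝ) ≤ x := le_trans (by exact_mod_cast (by
          have := mem_range.1 hn; omega : n ≤ w)) hwx
        exact ArithmeticFunction.vonMangoldt_le_log.trans (Real.log_le_log (by linarith) hnx)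
    · exact le_rfl
  calc ∑ n ∈ range (w + 1), ArithmeticFunction.vonMangoldt.residueClass a n
      ≤ ∑ n ∈ range (w + 1), (if (n : ZMod q) = a then Real.log x else 0) := sum_le_sum hterm
    _ = #((range (w + 1)).filter (fun n : ℕ => (n : ZMod q) = a)) * Real.log x := by
        rw [← sum_filter, sum_const, nsmul_eq_mul]
    _ ≤ (x / q + 2) * Real.log x :=
        mul_le_mul_of_nonneg_right (card_range_filter_zmod_le hq a w hwx) hlogx

/-! ### Bombieri–Vinogradov with a modulus-wise majorant -/

/-- **Bombieri–Vinogradov for primes, modulus-wise majorant.** For every `A` there are `B, C` such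
that for all large `x` there is `G : ℕ → ℝ≥0` with `|ψ(w; q, a) − w/φ(q)| ≤ G(q)` for all
`q ≤ x^{1/2}(log x)^{-B}`, all integer cut-offs `1 ≤ w ≤ x` and all reduced residues `a`, with
`G(q) ≤ 3 x log x · τ(q)/q` and `∑_{q ≤ x^{1/2}(log x)^{-B}} G(q) ≤ C x (log x)^{-A}`.  (`G(q)` is the
maximum over the finitely many cut-offs `w ≤ x` and units `a`; the sum bound is the tree's
`bombieri_vinogradov_holds` at the maximising cut-offs.) [cite: IwaniecKowalski2004, Theorem 17.1] -/
theorem bvLambda_sup : ∀ A : ℝ, ∃ B C : ℝ, ∀ᶠ x : ℝ in Filter.atTop, ∃ G : ℕ → ℝ, (∀ q, 0 ≤ G q) ∧ (∀ q ∈ Finset.Icc 1 ⌊x ^ (1 / 2 : ℝ) / Real.log x ^ B⌋₊, ∀ w : ℕ, 1 ≤ w → (w : ℝ) ≤ x → ∀ a : (ZMod q)ˣ, |chebyshevPsiMod q (a : ZMod q) w - w / Nat.totient q| ≤ G q) ∧ (∀ q ∈ Finset.Icc 1 ⌊x ^ (1 / 2 : ℝ) / Real.log x ^ B⌋₊, G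 q ≤ 3 * x * Real.log x * q.divisors.card / q) ∧ ∑ q ∈ Finset.Icc 1 ⌊x ^ (1 / 2 : ℝ) / Real.log x ^ B⌋₊, G q ≤ C * x / Real.log x ^ A := by
  intro A
  classical
  obtain ⟨B, C, hBV⟩ := bombieri_vinogradov_holds A
  refine ⟨B, C, ?_⟩
  filter_upwards [hBV, eventually_ge_atTop (16 : ℝ),
    Real.tendsto_log_atTop.eventually_ge_atTop (1 : ℝ),
    eventually_log_rpow_le_rpow' (-B) (by norm_num : (0 : ℝ) < 1 / 4)] with x hx h16 hlog1 hlogB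
  have hx1 : (1 : ℝ) ≤ x := by linarith
  have hx0 : (0 : ℝ) < x := by linarith
  -- the candidate cut-offs and the majorant
  set S : Finset ℕ := Icc 1 ⌊x⌋₊ with hS
  have hSne : S.Nonempty := ⟨1, by
    rw [hS, mem_Icc]; exact ⟨le_rfl, Nat.le_floor (by exact_mod_cast hx1)⟩⟩
  set F : ℕ → ℕ → ℝ := fun q w =>
    ⨆ a : (ZMod q)ˣ, |chebyshevPsiMod q (a : ZMod q) w - w / Nat.totient q| with hF
  have hy : ∀ q : ℕ, ∃ y ∈ S, ∀ w ∈ S, F q w ≤ F q y := fun q =>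
    Finset.exists_max_image S (F q) hSne
  choose y hyS hymax using hy
  have hyIcc : ∀ q, ((y q : ℕ) : ℝ) ∈ Set.Icc 1 x := by
    intro q
    have h := hyS q
    rw [hS, mem_Icc] at h
    refine ⟨by exact_mod_cast h.1, ?_⟩
    exact le_trans (by exact_mod_cast h.2) (Nat.floor_le hx0.le)
  have hF0 : ∀ q w, 0 ≤ F q w := fun q w => Real.iSup_nonneg fun _ => abs_nonneg _
  refine ⟨fun q => F q (y q), fun q => hF0 q (y q), ?_, ?_, ?_⟩
  · -- every discrepancy with cut-off `≤ x` is dominated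
    intro q hq w hw1 hwx a
    have hq1 : 1 ≤ q := (mem_Icc.1 hq).1
    haveI : NeZero q := ⟨by omega⟩
    have hwS : w ∈ S := by
      rw [hS, mem_Icc]; exact ⟨hw1, Nat.le_floor hwx⟩
    have hbdd : BddAbove (Set.range fun a : (ZMod q)ˣ =>
        |chebyshevPsiMod q (a : ZMod q) w - w / Nat.totient q|) := (Set.finite_range _).bddAbove
    calc |chebyshevPsiMod q (a : ZMod q) w - w / Nat.totient q|
        ≤ F q w := le_ciSup hbdd a
      _ ≤ F q (y q) := hymax q w hwS
  · -- the trivial bound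
    intro q hq
    have hq1 : 1 ≤ q := (mem_Icc.1 hq).1
    have hq0 : 0 < q := hq1
    haveI : NeZero q := ⟨by omega⟩
    have hq' : (0 : ℝ) < q := by exact_mod_cast hq0
    -- `q ≤ x^{1/2} (log x)^{-B} ≤ x^{3/4} ≤ x/2`
    have hqx : (q : ℝ) ≤ x / 2 := by
      have h1 : (q : ℝ) ≤ x ^ (1 / 2 : ℝ) / Real.log x ^ B :=
        le_trans (by exact_mod_cast (mem_Icc.1 hq).2) (Nat.floor_le (by positivity))
      have h2 : x ^ (1 / 2 : ℝ) / Real.log x ^ B ≤ x ^ (1 / 2 : ℝ) * x ^ (1 / 4 : ℝ) := by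
        rw [div_eq_mul_inv, ← Real.rpow_neg (by linarith)]
        exact mul_le_mul_of_nonneg_left hlogB (by positivity)
      have h3 : x ^ (1 / 2 : ℝ) * x ^ (1 / 4 : ℝ) = x ^ (3 / 4 : ℝ) := by
        rw [← Real.rpow_add hx0]; norm_num
      have h4 : x ^ (3 / 4 : ℝ) ≤ x / 2 := by
        have h5 : (2 : ℝ) ≤ x ^ (1 / 4 : ℝ) := by
          have : (16 : ℝ) ^ (1 / 4 : ℝ) = 2 := by
            rw [show (16 : ℝ) = 2 ^ (4 : ℝ) by norm_num, ← Real.rpow_mul (by norm_num)]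
            norm_num
          rw [← this]
          exact Real.rpow_le_rpow (by norm_num) h16 (by norm_num)
        have h6 : x ^ (3 / 4 : ℝ) * x ^ (1 / 4 : ℝ) = x := by
          rw [← Real.rpow_add hx0]; norm_num
        have h7 : 0 ≤ x ^ (3 / 4 : ℝ) := by positivity
        nlinarith
      linarith
    have hlogx : 0 ≤ Real.log x := by linarith
    have hτ1 : (1 : ℝ) ≤ q.divisors.card := by
      exact_mod_cast Finset.card_pos.2 ⟨1, Nat.one_mem_divisors.2 (by omega)⟩
    refine ciSup_le fun a => ?_
    have hyq := hyIcc q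
    have hψ := chebyshevPsiMod_le hq0 (a : ZMod q) (y q) hx1 hyq.2
    have hψ0 : 0 ≤ chebyshevPsiMod q (a : ZMod q) (y q) := by
      unfold chebyshevPsiMod
      exact sum_nonneg fun n _ => by
        unfold ArithmeticFunction.vonMangoldt.residueClass
        exact Set.indicator_nonneg (fun _ _ => ArithmeticFunction.vonMangoldt_nonneg) _
    have hφ : ((y q : ℕ) : ℝ) / Nat.totient q ≤ x * q.divisors.card / q := by
      rw [div_eq_mul_inv, mul_div_assoc]
      exact mul_le_mul hyq.2 (inv_totient_le hq1) (inv_nonneg.2 (Nat.cast_nonneg _)) hx0.le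
    have hφ0 : 0 ≤ ((y q : ℕ) : ℝ) / Nat.totient q := by positivity
    calc |chebyshevPsiMod q (a : ZMod q) (y q) - (y q : ℕ) / Nat.totient q|
        ≤ chebyshevPsiMod q (a : ZMod q) (y q) + (y q : ℕ) / Nat.totient q := by
          rw [abs_le]; constructor <;> linarith
      _ ≤ (x / q + 2) * Real.log x + x * q.divisors.card / q := add_le_add hψ hφ
      _ ≤ 2 * (x / q) * Real.log x * q.divisors.card + x * Real.log x * q.divisors.card / q := by
          have h1 : (x / q + 2) * Real.log x ≤ 2 * (x / q) * Real.log x := by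
            have : 2 ≤ x / q := by rw [le_div_iff₀ hq']; linarith
            nlinarith
          have h2 : 2 * (x / q) * Real.log x ≤ 2 * (x / q) * Real.log x * q.divisors.card := by
            have : 0 ≤ 2 * (x / q) * Real.log x := by positivity
            nlinarith
          have h3 : x * q.divisors.card / q ≤ x * Real.log x * q.divisors.card / q := by
            refine div_le_div_of_nonneg_right ?_ hq'.le
            have : 0 ≤ x * q.divisors.card := by positivity
            nlinarith
          linarith
      _ = 3 * x * Real.log x * q.divisors.card / q := by
          field_simp; ring
  · -- the Bombieri–Vinogradov sum at the maximising cut-offs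
    exact hx (fun q => ((y q : ℕ) : ℝ)) hyIcc

end Summit.Parity.GeneralizedHardyLittlewood.Cruxes.RelativeDimOne.SingleMoebiusSplit
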